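import Summits.QuantumFields.YangMills.Theorems.BalabanUVNodesN16AtRRec13SepLines
import Summits.QuantumFields.YangMills.Theorems.BalabanUVNodesRateReadingOfRecord13Sep

/-!
# Route «BalabanUVNodes», cluster K4 «SpineRates» — node N16 = NE3 AT dag-n22-e's NAMED STAGE-13 READING OF RECORD `readingOfRecord₁₃Sep w1 ℓ₃ ne2 ne1`: N16's
# consumer faces in the two currencies of record (`S_N16`, dag-n16-c's `S_N16Holder β`) and in the K3‴ skeleton's OWN currency at the LEVEL-SELECTED TUPLE READING OF
# RECORD — N21's `hcov` ∕ β-face with the letters `ℓ₃ F` displayed, the knit from `LeafSlot`, and ★ THE N16 LINE (N05's `Thm4Body` ∕ `Prop3Body` + N07's `LeafH3sup` once per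
# guarded family, letter lines displayed), every `hpin` discharged by `rfl`

⁗ EDITION (Record13Sep re-key, 2026-08-27): director-ym №136–№139 ⇒ node00-def-T `Node00/Record13.lean` v1.2 (p501191, DEPRECATE-AND-ADD) minted the SEPARATED
proviso `Stage13Params.Provisos₁₃Sep` (row P11's `bg` asked only at separated, part-compatible sequences) with `datumOfRecord₁₃Sep` ∕ `IsRecordOfRecord₁₃CSep`; RR-2's key twin
`Node00/Record13DatumKeySep` (`IsDatumOfRecord₁₃CSep(On∕N)`), dag-n22-e g6's (T-RATE) layer-B twins (`RateReading₁₃Sep`, `rateCarriersOfRecord₁₃Sep`, `RRec₁₃Sep`, `RRec₁₃SepOn`,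
`readingOfRecord₁₃Sep`, …) and plan's rev 18 (⁗ items keyed FLAT on `Provisos₁₃Sep`) followed.  THIS FILE is the TOKEN TWIN of this seat's ‴ module of the same name without
`Sep` under that map — statements = the ‴ statements with `Provisos₁₃ ↦ Provisos₁₃Sep`, `datumOfRecord₁₃ ↦ datumOfRecord₁₃Sep`, `(Is|is)DatumOfRecord₁₃C… ↦ …₁₃CSep…`, the layer-B
names suffixed after `₁₃`; proofs = the ‴ proofs verbatim; θ-level names (`Stage13Params`, `Admissible`, `unityNondeg₁₃`, RR-1's `ne3ConstLayerOfRecord₁₁`, …) VERBATIM; stage-free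
lemmas are NOT re-declared (imported from the ‴ modules BY NAME).  The ‴ item ids named below are ASIDES after rev 18; the lane is the ⁗ K3 id per dag-lead's KEY MAP.

Cell `pub-ymgap`, seat `pub-ymgap-dag-n16-e` (R134 acceleration seat (a), strategy s2 = BY-NAME KNIT at the record; HUMAN RULING D-0062; chair R424 venue),
generation 6, module 23 (THEOREMS ONLY, 0 `def`, 0 `sorry`).  `bears_on: R4∕N16 · out-edge N16 → N21 · K3‴ SpineGivenEndpointR13 (stmt-QuantumFields-19912,
`--supports … --as helper`)`.  pub-ymgap INBOX DAGN16E-G6-STARTED ∕ INTENT-23 (this seat's g5 HANDOFF trigger t5‴ «the named reading exists»).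

WHY.  Modules 19 `…N16AtRRec13Sep` (p494392), 20 `…N16AtRRec13SepLines` (p494677) and 21 `…N16AtTupleReading13Sep` (p493181) state N16's side of the Stage-13 record for a reading `𝔯`
(resp. a tuple reading `rr`) PINNED at RR-1's NE3 object of record through a hypothesis `hpin`.  dag-n22-e's 6″ `…RateReadingOfRecord13Sep` (p495075) has since NAMED the
Stage-13 reading of record `readingOfRecord₁₃Sep w1 ℓ₃ ne2 ne1 : RateReading₁₃Sep N` (N16's layer `:= ne3ConstReadingOfRecord₁₁ F N (ℓ₃ F)`, faces `readingOfRecord₁₃Sep_ne3` ∕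
`readingOfRecord₁₃Sep_ne3OfRecord`, both `rfl`) and its 8c″ §4 fixed the shape of the LEVEL-SELECTED TUPLE READING OF RECORD
`rr F θ hP g₀ os := rateCarriersOfRecord₁₃Sep (readingOfRecord₁₃Sep w1 ℓ₃ ne2 ne1) F θ hP g₀ os (ksel F θ g₀ os)` (plan g66's `KeyedRates rr` currency).  The K3‴ consumers at
that reading (dag-n27-c XL ∕ XLI `…N27At(Adm)ReadingOfRecord13`, dag-n21-d, the composer) would otherwise instantiate `hpin := rfl` at every call site; this module does it
ONCE, by name.  N16's component reads neither `w1` (W1's reading data) nor `ne2` ∕ `ne1` (residual) nor `ksel`: every theorem is generic in them.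

CONTENT (every theorem ONE application of a module-19∕20∕21 theorem at `hpin := rfl`).
§1 FACES WITHOUT LETTER LINES — `S_N16`: `covRoot_readingOfRecord₁₃SepOn` ∕ `covRoot_readingOfRecord₁₃Sep` (N21's `hcov`: `NE3EnergyRateWCov 4 (sfClass …) … (ne3DomOfRecord₁₁ F N 0 0)`
  with the letters `ℓ₃ F`), `s_N16_readingOfRecord₁₃SepOn_of_leafSlot` ∕ `s_N16_readingOfRecord₁₃Sep_of_leafSlot` (proviso + `LeafSlot` once per family ⇒ the stub);
  `S_N16Holder β`: `s_N16Holder_readingOfRecord₁₃SepOn_iff` ∕ `s_N16Holder_readingOfRecord₁₃Sep_iff`, `covRootHolder_readingOfRecord₁₃SepOn` (N21's β-face),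
  `s_N16Holder_readingOfRecord₁₃SepOn_of_leafSlotHolder`, `s_N16Holder_readingOfRecord₁₃SepOn_of_s_N16` (`β ≤ 1`, `0 ≤ Λ₂'`); tuple currency:
  `n16_tupleReadingOfRecordSep_iff` ∕ `n16_tupleReadingOfRecordSepOn_iff`, `n16_tupleReadingOfRecordSepOn_of_leafSlot`, and the bridge
  `s_N16_readingOfRecord₁₃SepOn_iff_n16_tupleReadingOfRecordSepOn` (home-keyed stub ⟷ skeleton conjunct at the SAME named reading).
§2 ★ THE N16 LINE AT THE NAMED READING, LINEAR CURRENCY (β = 1, the stub of record) — `s_N16_readingOfRecord₁₃SepOn_of_window_linear` ∕ `s_N16_readingOfRecord₁₃Sep_of_window_linear`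
  and, in the skeleton's currency, `n16_tupleReadingOfRecordSepOn_of_window_linear` ∕ `n16_tupleReadingOfRecordSep_of_window_linear` (module 20 §4 ∕ module 21 §2 at `rfl`).
§3 ★ THE N16 LINE AT THE NAMED READING AT EXPONENT `β ∈ [0, 1]` — `s_N16Holder_readingOfRecord₁₃SepOn_of_window_linear` ∕ `s_N16Holder_readingOfRecord₁₃Sep_of_window_linear`
  (module 20 §5 at `rfl`; dag-n16-c's β-kit thresholds `radiusOfRecordH` ∕ `constOfRecordH`).

NOT RESTATED (cited by name): 6″'s own `s_N16_readingOfRecord₁₃Sep_iff`, `n16At_of_s_N16_readingOfRecord₁₃Sep`, `s_N16_readingOfRecord₁₃SepOn_iff`.  The MS currency's faces at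
the named reading are module 22's §4 (`…N16HolderMSAtRecord13Sep`).

HONEST FRAMING.  Kernel bookkeeping by name; no estimate; N05's `Thm4Body` ∕ `Prop3Body` ([Balaban1985RegularSpaces] Thm 4 ∕ Prop 3 as typed by n05-a, all-torus sub-family)
and N07's `LeafH3sup` ([Balaban1985Variational] Thm 1 (8)+(10) TYPE) are HYPOTHESES asserted for no family; `S_N16Holder β` is a CANDIDATE stub wording (R-β UNRULED); the
reading's `w1` ∕ `ne2` ∕ `ne1` and the selector `ksel` are residual DATA ∕ PARAMETERS; no admissible Stage-13 tuple with provisos is claimed to exist (K0‴ `Record13Inhabited`,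
stmt-QuantumFields-19909, OPEN); nothing of Bałaban's asserted; **N16 ∕ NE3 is NOT discharged**; count-neutral (typed 28∕28 · discharged 5∕27, A 5∕28 UNMOVED); one finite
four-torus at fixed ε — NOT ℝ⁴, NOT infinite volume, NOT OS, NOT a mass gap, NOT Clay.  No decl below carries a cite tag (all `[folklore]` bookkeeping).
-/

set_option autoImplicit false

open scoped BigOperators Matrix Matrix.Norms.L2Operator
open NormedSpace

namespace Summit.QuantumFields.YangMills.BalabanUVNodes.N16AtReadingOfRecord13Sep

open Literature.MathematicalPhysics.QuantumFieldTheory.Balaban1983to89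
open Literature.MathematicalPhysics.QuantumFieldTheory.Balaban1983to89.T4Continuum (T4Family ULoop)
open B7Prop1Explicit B7Prop2Explicit
open B7Prop3Flat (c3)
open B8LeafModelZd (ZdIdx)
open B8LeafModelZd3 (zdGF3)
open Node00 (IsDatumOfRecord₁₃CSep Stage13Params NE3Objects₁₁ NE3Letters₁₁ NE2Objects₁₁ ne3LOfRecord₁₁ ne3ConstLayerOfRecord₁₁ ne3NperOfRecord₁₁ ne3DomOfRecord₁₁ MatA)
open Node00.W1 (ReadingData)
open Summit.QuantumFields.BalabanUV.T4Continuum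
open MinimalActionRate (sfClass)
open BlockAverageCurrent (curConst)
open NE3RightInverseSupLetters (frameC)
open NE3.LeafIndexSockets (LeafH3sup)
open NE3EnergyWeightedCovShape (NE3EnergyRateWCov)
open YMDAG.UVSplit (Datum NE3Carriers NE1pCarriers RateCarriers N16At S_N16 ne3OfRecord₁₁ RateReading₁₃Sep rateCarriersOfRecord₁₃Sep RRec₁₃Sep RRec₁₃SepOn readingOfRecord₁₃Sep
  readingOfRecord₁₃Sep_ne3)
open Summit.QuantumFields.YangMills.BalabanUVNodes.N16Regime (InEndRegime radiusOfRecord constOfRecord)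
open Summit.QuantumFields.YangMills.BalabanUVNodes.N16LeafSlot (LeafSlot n16At_of_inEndRegime_leafSlot)
open Summit.QuantumFields.YangMills.BalabanUVNodes.N16HolderDefs (CovRootHolder N16HolderAt S_N16Holder)
open Summit.QuantumFields.YangMills.BalabanUVNodes.N16HolderRegime (InEndRegimeH radiusOfRecordH constOfRecordH)
open Summit.QuantumFields.YangMills.BalabanUVNodes.N16HolderLeafSlot (LeafSlotHolder)
open Summit.QuantumFields.YangMills.BalabanUVNodes.N16AtRRec13Sep (covRoot_rRec₁₃SepOn covRoot_rRec₁₃Sep s_N16_rRec₁₃SepOn_ofRecord_of_leafSlot s_N16_rRec₁₃Sep_of_constLayer_leafSlot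
  s_N16_rRec₁₃SepOn_iff_n16_tupleReadingOn_ofRecord)
open Summit.QuantumFields.YangMills.BalabanUVNodes.N16AtRRec13SepLines (s_N16Holder_rRec₁₃SepOn_iff_ofRecord s_N16Holder_rRec₁₃Sep_iff_of_constLayer covRootHolder_rRec₁₃SepOn_ofRecord
  s_N16Holder_rRec₁₃SepOn_of_constLayer_leafSlotHolder s_N16Holder_rRec₁₃SepOn_ofRecord_of_s_N16 s_N16_rRec₁₃SepOn_ofRecord_of_window_linear s_N16_rRec₁₃Sep_ofRecord_of_window_linear
  s_N16Holder_rRec₁₃SepOn_ofRecord_of_window_linear s_N16Holder_rRec₁₃Sep_ofRecord_of_window_linear)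
open Summit.QuantumFields.YangMills.BalabanUVNodes.N16AtTupleReading13Sep (n16_tupleReading_iff_of_constLayer n16_tupleReadingOn_iff_of_constLayer
  n16_tupleReading_ofRecord_of_leafSlot n16_tupleReading_ofRecord_of_window_linear n16_tupleReadingOn_ofRecord_of_window_linear)

noncomputable section

variable {N : ℕ} [NeZero N] (β : ℝ) (Rg : (F : T4Family) → Stage13Params F N → Prop)
  (w1 : (F : T4Family) → (θ : Stage13Params F N) → ReadingData F (MatA N) θ.τ9.M) (ℓ₃ : T4Family → NE3Letters₁₁)
  (ne2 : (F : T4Family) → Stage13Params F N → (ℕ → ℝ) → List (ULoop F) → ℕ → NE2Objects₁₁)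
  (ne1 : (F : T4Family) → Stage13Params F N → (ℕ → ℝ) → List (ULoop F) → NE1pCarriers)
  (ksel : (F : T4Family) → Stage13Params F N → (ℕ → ℝ) → List (ULoop F) → ℕ)

/-! ## §1 Faces without letter lines, in the three currencies -/

/-- **N21's FACE AT THE REGIME-RESTRICTED READING OF RECORD** — under `S_N16 (RRec₁₃SepOn (readingOfRecord₁₃Sep w1 ℓ₃ ne2 ne1) Rg)`, at every guarded admissible tuple with provisos the
covariant root `NE3EnergyRateWCov` at RR-1's period `ne3NperOfRecord₁₁ F 0 0 = 2·L^m`, the reading's letters `ℓ₃ F` and the data of record `ne3DomOfRecord₁₁ F N 0 0` (module 19's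
`covRoot_rRec₁₃SepOn`, the layer by `rfl`). [folklore] -/
theorem covRoot_readingOfRecord₁₃SepOn (hS : S_N16 (RRec₁₃SepOn (readingOfRecord₁₃Sep w1 ℓ₃ ne2 ne1) Rg)) (F : T4Family) {θ : Stage13Params F N} (hP : θ.Provisos₁₃Sep F N)
    (hRg : Rg F θ) (hθ : θ.Admissible F N) :
    NE3EnergyRateWCov 4 (sfClass 4 (ne3LOfRecord₁₁ F) (ne3NperOfRecord₁₁ F 0 0) (ℓ₃ F).ε) (ne3LOfRecord₁₁ F) (ne3NperOfRecord₁₁ F 0 0) (ℓ₃ F).b (ℓ₃ F).g (ℓ₃ F).C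
      (ℓ₃ F).Λ₁ (ℓ₃ F).Λ₂' (ne3DomOfRecord₁₁ F N 0 0) :=
  covRoot_rRec₁₃SepOn _ Rg hS F θ hP hRg hθ (fun _ => 0) [] 0

/-- **N21's FACE AT THE CANONICAL READING OF RECORD** (one family carrying a Stage-13 datum of record). [folklore] -/
theorem covRoot_readingOfRecord₁₃Sep (hS : S_N16 (RRec₁₃Sep (readingOfRecord₁₃Sep w1 ℓ₃ ne2 ne1))) (F : T4Family) {D : Datum F N} (hD : IsDatumOfRecord₁₃CSep F N D) :
    NE3EnergyRateWCov 4 (sfClass 4 (ne3LOfRecord₁₁ F) (ne3NperOfRecord₁₁ F 0 0) (ℓ₃ F).ε) (ne3LOfRecord₁₁ F) (ne3NperOfRecord₁₁ F 0 0) (ℓ₃ F).b (ℓ₃ F).g (ℓ₃ F).C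
      (ℓ₃ F).Λ₁ (ℓ₃ F).Λ₂' (ne3DomOfRecord₁₁ F N 0 0) :=
  covRoot_rRec₁₃Sep _ hS F D hD (fun _ => 0) [] 0

/-- **THE KNIT AT THE REGIME-RESTRICTED READING OF RECORD, LEAF FORM**: the proviso `InEndRegime` and `LeafSlot` at RR-1's one bundle of every guarded family ⇒ the stub
(module 19's `s_N16_rRec₁₃SepOn_ofRecord_of_leafSlot` at `rfl`; what dag-n27-c's XL `…_of_leafSlot` reads). [folklore] -/
theorem s_N16_readingOfRecord₁₃SepOn_of_leafSlot
    (h : ∀ (F : T4Family), (∃ θ : Stage13Params F N, θ.Provisos₁₃Sep F N ∧ Rg F θ ∧ θ.Admissible F N) →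
      InEndRegime (ne3OfRecord₁₁ F (ne3ConstLayerOfRecord₁₁ F N (ℓ₃ F))) ∧ LeafSlot (ne3OfRecord₁₁ F (ne3ConstLayerOfRecord₁₁ F N (ℓ₃ F)))) :
    S_N16 (RRec₁₃SepOn (readingOfRecord₁₃Sep w1 ℓ₃ ne2 ne1) Rg) :=
  s_N16_rRec₁₃SepOn_ofRecord_of_leafSlot _ Rg ℓ₃ (readingOfRecord₁₃Sep_ne3 w1 ℓ₃ ne2 ne1) h

/-- **THE KNIT AT THE CANONICAL READING OF RECORD, LEAF FORM** (one family carrying a Stage-13 datum of record). [folklore] -/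
theorem s_N16_readingOfRecord₁₃Sep_of_leafSlot
    (h : ∀ (F : T4Family), (∃ D : Datum F N, IsDatumOfRecord₁₃CSep F N D) →
      InEndRegime (ne3OfRecord₁₁ F (ne3ConstLayerOfRecord₁₁ F N (ℓ₃ F))) ∧ LeafSlot (ne3OfRecord₁₁ F (ne3ConstLayerOfRecord₁₁ F N (ℓ₃ F)))) :
    S_N16 (RRec₁₃Sep (readingOfRecord₁₃Sep w1 ℓ₃ ne2 ne1)) :=
  s_N16_rRec₁₃Sep_of_constLayer_leafSlot _ (fun F => ne3ConstLayerOfRecord₁₁ F N (ℓ₃ F)) (readingOfRecord₁₃Sep_ne3 w1 ℓ₃ ne2 ne1) h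

/-- **`S_N16Holder β` AT THE REGIME-RESTRICTED READING OF RECORD** IS «`N16HolderAt (ne3OfRecord₁₁ F (ne3ConstLayerOfRecord₁₁ F N (ℓ₃ F))) β` for every family carrying an
admissible Stage-13 tuple with provisos in `Rg`» (module 20's `s_N16Holder_rRec₁₃SepOn_iff_ofRecord` at `rfl`). [folklore] -/
theorem s_N16Holder_readingOfRecord₁₃SepOn_iff :
    S_N16Holder β (RRec₁₃SepOn (readingOfRecord₁₃Sep w1 ℓ₃ ne2 ne1) Rg) ↔
      ∀ (F : T4Family), (∃ θ : Stage13Params F N, θ.Provisos₁₃Sep F N ∧ Rg F θ ∧ θ.Admissible F N) →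
        N16HolderAt (ne3OfRecord₁₁ F (ne3ConstLayerOfRecord₁₁ F N (ℓ₃ F))) β :=
  s_N16Holder_rRec₁₃SepOn_iff_ofRecord β _ Rg ℓ₃ (readingOfRecord₁₃Sep_ne3 w1 ℓ₃ ne2 ne1)

/-- **`S_N16Holder β` AT THE CANONICAL READING OF RECORD** IS «`N16HolderAt … β` for every family carrying a Stage-13 datum of record». [folklore] -/
theorem s_N16Holder_readingOfRecord₁₃Sep_iff :
    S_N16Holder β (RRec₁₃Sep (readingOfRecord₁₃Sep w1 ℓ₃ ne2 ne1)) ↔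
      ∀ (F : T4Family), (∃ D : Datum F N, IsDatumOfRecord₁₃CSep F N D) → N16HolderAt (ne3OfRecord₁₁ F (ne3ConstLayerOfRecord₁₁ F N (ℓ₃ F))) β :=
  s_N16Holder_rRec₁₃Sep_iff_of_constLayer β _ (fun F => ne3ConstLayerOfRecord₁₁ F N (ℓ₃ F)) (readingOfRecord₁₃Sep_ne3 w1 ℓ₃ ne2 ne1)

/-- **N21's β-FACE AT THE REGIME-RESTRICTED READING OF RECORD**: under the candidate stub, the β-root `CovRootHolder` at RR-1's period, the reading's letters `ℓ₃ F` and the data of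
record, at every guarded family (module 20's `covRootHolder_rRec₁₃SepOn_ofRecord` at `rfl`). [folklore] -/
theorem covRootHolder_readingOfRecord₁₃SepOn (hS : S_N16Holder β (RRec₁₃SepOn (readingOfRecord₁₃Sep w1 ℓ₃ ne2 ne1) Rg)) (F : T4Family) {θ : Stage13Params F N}
    (hP : θ.Provisos₁₃Sep F N) (hRg : Rg F θ) (hθ : θ.Admissible F N) :
    CovRootHolder 4 (sfClass 4 (ne3LOfRecord₁₁ F) (ne3NperOfRecord₁₁ F 0 0) (ℓ₃ F).ε) (ne3LOfRecord₁₁ F) (ne3NperOfRecord₁₁ F 0 0) (ℓ₃ F).b (ℓ₃ F).g (ℓ₃ F).C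
      (ℓ₃ F).Λ₁ (ℓ₃ F).Λ₂' β (ne3DomOfRecord₁₁ F N 0 0) :=
  covRootHolder_rRec₁₃SepOn_ofRecord β _ Rg ℓ₃ (readingOfRecord₁₃Sep_ne3 w1 ℓ₃ ne2 ne1) hS F hP hRg hθ

/-- **THE KNIT AT THE REGIME-RESTRICTED READING OF RECORD, HOLDER LEAF FORM** (`0 ≤ β ≤ 1`): the H-proviso `InEndRegimeH` and dag-n16-c's `LeafSlotHolder · β` at RR-1's one bundle
of every guarded family ⇒ `S_N16Holder β` there (module 20 §2b's closer at `rfl`). [folklore] -/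
theorem s_N16Holder_readingOfRecord₁₃SepOn_of_leafSlotHolder (hβ0 : 0 ≤ β) (hβ1 : β ≤ 1)
    (h : ∀ (F : T4Family), (∃ θ : Stage13Params F N, θ.Provisos₁₃Sep F N ∧ Rg F θ ∧ θ.Admissible F N) →
      InEndRegimeH (ne3OfRecord₁₁ F (ne3ConstLayerOfRecord₁₁ F N (ℓ₃ F))) ∧ LeafSlotHolder (ne3OfRecord₁₁ F (ne3ConstLayerOfRecord₁₁ F N (ℓ₃ F))) β) :
    S_N16Holder β (RRec₁₃SepOn (readingOfRecord₁₃Sep w1 ℓ₃ ne2 ne1) Rg) :=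
  s_N16Holder_rRec₁₃SepOn_of_constLayer_leafSlotHolder β _ Rg hβ0 hβ1 (fun F => ne3ConstLayerOfRecord₁₁ F N (ℓ₃ F)) (readingOfRecord₁₃Sep_ne3 w1 ℓ₃ ne2 ne1) h

/-- **THE `β ≤ 1` WEAKENING AT THE REGIME-RESTRICTED READING OF RECORD**: `S_N16 → S_N16Holder β` for `β ≤ 1` whenever the reading's letters carry a non-negative Hölder letter
`0 ≤ (ℓ₃ F).Λ₂'`. [folklore] -/
theorem s_N16Holder_readingOfRecord₁₃SepOn_of_s_N16 (hβ : β ≤ 1) (hΛ : ∀ F : T4Family, 0 ≤ (ℓ₃ F).Λ₂') (hS : S_N16 (RRec₁₃SepOn (readingOfRecord₁₃Sep w1 ℓ₃ ne2 ne1) Rg)) :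
    S_N16Holder β (RRec₁₃SepOn (readingOfRecord₁₃Sep w1 ℓ₃ ne2 ne1) Rg) :=
  s_N16Holder_rRec₁₃SepOn_ofRecord_of_s_N16 β _ Rg ℓ₃ (readingOfRecord₁₃Sep_ne3 w1 ℓ₃ ne2 ne1) hβ hΛ hS

/-- **IN THE K3‴ SKELETON's CURRENCY — THE N16 CONJUNCT OF `KeyedRates rr` AT THE LEVEL-SELECTED TUPLE READING OF RECORD IS ONE `N16At` PER FAMILY CARRYING AN ADMISSIBLE
TUPLE WITH PROVISOS** (`rr F θ hP g₀ os := rateCarriersOfRecord₁₃Sep (readingOfRecord₁₃Sep w1 ℓ₃ ne2 ne1) F θ hP g₀ os (ksel F θ g₀ os)`, dag-n22-e 8c″ §4's shape; the unguarded binder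
of plan g66's `KeyedRates`; module 21's `n16_tupleReading_iff_of_constLayer`, the component by `readingOfRecord₁₃Sep_ne3OfRecord`, `rfl`). [folklore] -/
theorem n16_tupleReadingOfRecordSep_iff :
    (∀ (F : T4Family) (θ : Stage13Params F N) (hP : θ.Provisos₁₃Sep F N), θ.Admissible F N → ∀ (g₀ : ℕ → ℝ) (os : List (ULoop F)),
        N16At (rateCarriersOfRecord₁₃Sep (readingOfRecord₁₃Sep w1 ℓ₃ ne2 ne1) F θ hP g₀ os (ksel F θ g₀ os)).ne3) ↔
      ∀ (F : T4Family), (∃ θ : Stage13Params F N, θ.Provisos₁₃Sep F N ∧ θ.Admissible F N) → N16At (ne3OfRecord₁₁ F (ne3ConstLayerOfRecord₁₁ F N (ℓ₃ F))) :=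
  n16_tupleReading_iff_of_constLayer (fun F θ hP g₀ os => rateCarriersOfRecord₁₃Sep (readingOfRecord₁₃Sep w1 ℓ₃ ne2 ne1) F θ hP g₀ os (ksel F θ g₀ os))
    (fun F => ne3ConstLayerOfRecord₁₁ F N (ℓ₃ F)) fun _ _ _ _ _ => rfl

/-- **… AND GUARDED** (rev 16's binder prefix `Rg F θ →`, e.g. `Rg := unityNondeg₁₃ N`). [folklore] -/
theorem n16_tupleReadingOfRecordSepOn_iff :
    (∀ (F : T4Family) (θ : Stage13Params F N) (hP : θ.Provisos₁₃Sep F N), Rg F θ → θ.Admissible F N → ∀ (g₀ : ℕ → ℝ) (os : List (ULoop F)),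
        N16At (rateCarriersOfRecord₁₃Sep (readingOfRecord₁₃Sep w1 ℓ₃ ne2 ne1) F θ hP g₀ os (ksel F θ g₀ os)).ne3) ↔
      ∀ (F : T4Family), (∃ θ : Stage13Params F N, θ.Provisos₁₃Sep F N ∧ Rg F θ ∧ θ.Admissible F N) → N16At (ne3OfRecord₁₁ F (ne3ConstLayerOfRecord₁₁ F N (ℓ₃ F))) :=
  n16_tupleReadingOn_iff_of_constLayer (fun F θ hP g₀ os => rateCarriersOfRecord₁₃Sep (readingOfRecord₁₃Sep w1 ℓ₃ ne2 ne1) F θ hP g₀ os (ksel F θ g₀ os)) Rg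
    (fun F => ne3ConstLayerOfRecord₁₁ F N (ℓ₃ F)) fun _ _ _ _ _ => rfl

/-- **THE GUARDED N16 CONJUNCT AT THE LEVEL-SELECTED TUPLE READING OF RECORD FROM `LeafSlot`**: proviso + `LeafSlot` at RR-1's one bundle of every guarded family ⇒ the conjunct
(the bridge below ∘ the leaf-form knit). [folklore] -/
theorem n16_tupleReadingOfRecordSepOn_of_leafSlot
    (h : ∀ (F : T4Family), (∃ θ : Stage13Params F N, θ.Provisos₁₃Sep F N ∧ Rg F θ ∧ θ.Admissible F N) →
      InEndRegime (ne3OfRecord₁₁ F (ne3ConstLayerOfRecord₁₁ F N (ℓ₃ F))) ∧ LeafSlot (ne3OfRecord₁₁ F (ne3ConstLayerOfRecord₁₁ F N (ℓ₃ F)))) :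
    ∀ (F : T4Family) (θ : Stage13Params F N) (hP : θ.Provisos₁₃Sep F N), Rg F θ → θ.Admissible F N → ∀ (g₀ : ℕ → ℝ) (os : List (ULoop F)),
      N16At (rateCarriersOfRecord₁₃Sep (readingOfRecord₁₃Sep w1 ℓ₃ ne2 ne1) F θ hP g₀ os (ksel F θ g₀ os)).ne3 :=
  (n16_tupleReadingOfRecordSepOn_iff Rg w1 ℓ₃ ne2 ne1 ksel).2 fun F hF =>
    n16At_of_inEndRegime_leafSlot (h F hF).1 (h F hF).2

/-- **THE TWO STAGE-13 CURRENCIES AGREE AT THE NAMED READING**: the home-keyed stub `S_N16 (RRec₁₃SepOn (readingOfRecord₁₃Sep …) Rg)` iff the guarded N16 conjunct of `KeyedRates rr` at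
the level-selected tuple reading OF THE SAME named reading — both are «`N16At` at RR-1's object once per guarded family» (module 19 §6b at two `rfl` pins). [folklore] -/
theorem s_N16_readingOfRecord₁₃SepOn_iff_n16_tupleReadingOfRecordSepOn :
    S_N16 (RRec₁₃SepOn (readingOfRecord₁₃Sep w1 ℓ₃ ne2 ne1) Rg) ↔
      ∀ (F : T4Family) (θ : Stage13Params F N) (hP : θ.Provisos₁₃Sep F N), Rg F θ → θ.Admissible F N → ∀ (g₀ : ℕ → ℝ) (os : List (ULoop F)),
        N16At (rateCarriersOfRecord₁₃Sep (readingOfRecord₁₃Sep w1 ℓ₃ ne2 ne1) F θ hP g₀ os (ksel F θ g₀ os)).ne3 :=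
  s_N16_rRec₁₃SepOn_iff_n16_tupleReadingOn_ofRecord _ Rg ℓ₃
    (fun F θ hP g₀ os => rateCarriersOfRecord₁₃Sep (readingOfRecord₁₃Sep w1 ℓ₃ ne2 ne1) F θ hP g₀ os (ksel F θ g₀ os)) (readingOfRecord₁₃Sep_ne3 w1 ℓ₃ ne2 ne1)
    fun _ _ _ _ _ => rfl

/-! ## §2 ★ THE N16 LINE AT THE NAMED READING OF RECORD, LINEAR CURRENCY (β = 1: the stub of record `S_N16` and the skeleton's conjunct) -/

section LineOfRecord

variable
  -- N05's constants, per family; the averaging letter in N05's window and N07's leaf letters, per family (module 20 §4 ∕ module 21 §2, verbatim)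
  {len : T4Family → Site 4 → ℝ} {c₁ c₁' B₁' cP C₂ B₀β : T4Family → ℝ} {inp : T4Family → B8.B9Inputs} {α b' c' : T4Family → ℝ}
  (hlen : ∀ (F : T4Family) (v : Site 4), 0 < len F v → 1 ≤ len F v) (hlen1 : ∀ (F : T4Family) (μ : Fin 4), len F (e μ) = 1)
  (hB₁' : ∀ F, 0 < B₁' F) (hBB : ∀ F : T4Family, 5 * ((4 : ℕ) : ℝ) * F.L * (inp F).B₀ ≤ B₁' F) (hc₁' : ∀ F, 0 < c₁' F)
  (hwin : ∀ (F : T4Family) (α₀ α₁ : ℝ), 0 < α₀ → 0 < α₁ → α₀ + α₁ ≤ c₁' F →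
    α₀ + α₁ ≤ c₁ F ∧ C0 4 * (2 * α₀) ≤ 1 / 3 ∧ 4 * α₀ ≤ c2' 4 F.L ∧ 16 * (B₁' F * (α₀ + α₁)) ≤ 1 ∧
    Real.exp (4 * (800 * (((4 : ℕ) : ℝ) + 1) ^ 2 * (((4 : ℕ) : ℝ) + 4)) * α₀) * (1 + 8 * (131072 * (((4 : ℕ) : ℝ) + 1) ^ 2) * (B₁' F * (α₀ + α₁))) ≤ 2 ∧
    2 * (B₁' F * (α₀ + α₁)) ≤ c3 4 F.L ∧ ((4 : ℕ) : ℝ) * F.L * α₁ ≤ 1 / 8 ∧ α₀ ≤ cP F ∧ α₁ ≤ cP F ∧ B₁' F * (α₀ + α₁) ≤ cP F ∧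
    2 * (B₁' F * (α₀ + α₁)) ^ 2 + 20 * ((4 : ℕ) : ℝ) * α₀ * (B₁' F * (α₀ + α₁)) + 2 * C₂ F * (B₁' F * (α₀ + α₁)) ^ 2 ≤ α₀ + α₁)
  (hα : ∀ F, 0 < α F) (hα1 : ∀ F, α F ≤ c₁' F / 177)
  (hα2 : ∀ F : T4Family, α F ≤ (ℓ₃ F).Λ₁ / (1770 * (5 * ((4 : ℕ) : ℝ) * F.L * (inp F).B₀) + 1))
  (hα3 : ∀ F : T4Family, α F ≤ c2' 4 F.L / 2)
  (hα4 : ∀ F : T4Family, α F ≤ 1 / ((23040 * (4 : ℝ) ^ 4 * (frameC 4 F.L + 4) ^ 3 + 12) * (1 + curConst 4 F.L) + 1))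
  (hα5 : ∀ F, α F ≤ 1 / 10 ^ 9)
  (hg : ∀ F, 0 < (ℓ₃ F).g) (hε0 : ∀ F, 0 < (ℓ₃ F).ε) (hε : ∀ F, (ℓ₃ F).ε < α F)
  (hΛ₁r : ∀ F : T4Family, (ℓ₃ F).Λ₁ ≤ radiusOfRecord N F.L (ne3NperOfRecord₁₁ F 0 0))
  (hb : ∀ F, 0 ≤ (ℓ₃ F).b ∧ (ℓ₃ F).b ≤ (ℓ₃ F).ε / 2) (hC : ∀ F : T4Family, constOfRecord N F.L (ne3NperOfRecord₁₁ F 0 0) (ℓ₃ F).g ≤ (ℓ₃ F).C)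
  (hΛ₂' : ∀ F : T4Family, 177 * α F * (5 * ((4 : ℕ) : ℝ) * F.L * B₀β F + 5 * ((4 : ℕ) : ℝ) * F.L * (inp F).B₀) ≤ (ℓ₃ F).Λ₂')
  (hb' : ∀ F, 0 ≤ b' F ∧ b' F ≤ α F / 2048) (hc' : ∀ F, 0 ≤ c' F ∧ c' F ≤ α F / 24)
include hlen hlen1 hB₁' hBB hc₁' hwin hα hα1 hα2 hα3 hα4 hα5 hg hε0 hε hΛ₁r hb hC hΛ₂' hb' hc'

/-- ★ **THE N16 LINE AT THE REGIME-RESTRICTED READING OF RECORD, LINEAR CURRENCY** — with windowed letters `ℓ₃ F` (the lines displayed as hypotheses), the three content clauses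
(N05's `Thm4Body` ∕ `Prop3Body` on the univ sub-family of `zdGF3 (M_N ℂ) F.L 1 (len F)`, N07's `LeafH3sup` at `(ℓ₃ F).ε, b' F, c' F`) ONCE per guarded family give the K3‴
composer's `h16 : S_N16 (RRec₁₃SepOn (readingOfRecord₁₃Sep w1 ℓ₃ ne2 ne1) Rg)` (module 20 §4 at `rfl`). [folklore] -/
theorem s_N16_readingOfRecord₁₃SepOn_of_window_linear
    (hcontent : ∀ (F : T4Family), (∃ θ : Stage13Params F N, θ.Provisos₁₃Sep F N ∧ Rg F θ ∧ θ.Admissible F N) →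
      letI : CStarAlgebra (Matrix (Fin N) (Fin N) ℂ) := {}
      B8.Thm4Body (c₁ F) (B₁' F) (fun i : {i : ZdIdx 4 F.L // i.Ω 0 = Set.univ} => (zdGF3 (Matrix (Fin N) (Fin N) ℂ) F.L 1 (len F) i.1).toGFData) ∧
        B8.Prop3Body (cP F) 4 (F.L : ℝ) (C₂ F) (inp F) (B₀β F)
          (fun i : {i : ZdIdx 4 F.L // i.Ω 0 = Set.univ} => (zdGF3 (Matrix (Fin N) (Fin N) ℂ) F.L 1 (len F) i.1).toGFData2) ∧
        LeafH3sup 4 F.L (ne3NperOfRecord₁₁ F 0 0) (ℓ₃ F).ε (b' F) (c' F) (ne3DomOfRecord₁₁ F N 0 0)) :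
    S_N16 (RRec₁₃SepOn (readingOfRecord₁₃Sep w1 ℓ₃ ne2 ne1) Rg) :=
  s_N16_rRec₁₃SepOn_ofRecord_of_window_linear _ Rg ℓ₃ (readingOfRecord₁₃Sep_ne3 w1 ℓ₃ ne2 ne1) hlen hlen1 hB₁' hBB hc₁' hwin hα hα1 hα2 hα3 hα4 hα5 hg hε0 hε hΛ₁r hb hC hΛ₂'
    hb' hc' hcontent

/-- **THE N16 LINE AT THE CANONICAL READING OF RECORD, LINEAR CURRENCY** (content once per family carrying a Stage-13 datum of record; dag-n21-d's `h16`). [folklore] -/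
theorem s_N16_readingOfRecord₁₃Sep_of_window_linear
    (hcontent : ∀ (F : T4Family), (∃ D : Datum F N, IsDatumOfRecord₁₃CSep F N D) →
      letI : CStarAlgebra (Matrix (Fin N) (Fin N) ℂ) := {}
      B8.Thm4Body (c₁ F) (B₁' F) (fun i : {i : ZdIdx 4 F.L // i.Ω 0 = Set.univ} => (zdGF3 (Matrix (Fin N) (Fin N) ℂ) F.L 1 (len F) i.1).toGFData) ∧
        B8.Prop3Body (cP F) 4 (F.L : ℝ) (C₂ F) (inp F) (B₀β F)
          (fun i : {i : ZdIdx 4 F.L // i.Ω 0 = Set.univ} => (zdGF3 (Matrix (Fin N) (Fin N) ℂ) F.L 1 (len F) i.1).toGFData2) ∧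
        LeafH3sup 4 F.L (ne3NperOfRecord₁₁ F 0 0) (ℓ₃ F).ε (b' F) (c' F) (ne3DomOfRecord₁₁ F N 0 0)) :
    S_N16 (RRec₁₃Sep (readingOfRecord₁₃Sep w1 ℓ₃ ne2 ne1)) :=
  s_N16_rRec₁₃Sep_ofRecord_of_window_linear _ ℓ₃ (readingOfRecord₁₃Sep_ne3 w1 ℓ₃ ne2 ne1) hlen hlen1 hB₁' hBB hc₁' hwin hα hα1 hα2 hα3 hα4 hα5 hg hε0 hε hΛ₁r hb hC hΛ₂' hb' hc'
    hcontent

/-- ★ **THE N16 LINE IN THE K3‴ SKELETON's CURRENCY AT THE LEVEL-SELECTED TUPLE READING OF RECORD, GUARDED** — the same content once per guarded family gives rev 16's binder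
«`∀ F θ hP, Rg F θ → θ.Admissible F N → ∀ g₀ os, N16At (rr F θ hP g₀ os).ne3`» at `rr := rateCarriersOfRecord₁₃Sep (readingOfRecord₁₃Sep w1 ℓ₃ ne2 ne1) · · · · · (ksel …)`
(module 21's `n16_tupleReadingOn_ofRecord_of_window_linear` at `rfl`; the composer conjoins it with the other five nodes' conjuncts at the same `rr`). [folklore] -/
theorem n16_tupleReadingOfRecordSepOn_of_window_linear
    (hcontent : ∀ (F : T4Family), (∃ θ : Stage13Params F N, θ.Provisos₁₃Sep F N ∧ Rg F θ ∧ θ.Admissible F N) →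
      letI : CStarAlgebra (Matrix (Fin N) (Fin N) ℂ) := {}
      B8.Thm4Body (c₁ F) (B₁' F) (fun i : {i : ZdIdx 4 F.L // i.Ω 0 = Set.univ} => (zdGF3 (Matrix (Fin N) (Fin N) ℂ) F.L 1 (len F) i.1).toGFData) ∧
        B8.Prop3Body (cP F) 4 (F.L : ℝ) (C₂ F) (inp F) (B₀β F)
          (fun i : {i : ZdIdx 4 F.L // i.Ω 0 = Set.univ} => (zdGF3 (Matrix (Fin N) (Fin N) ℂ) F.L 1 (len F) i.1).toGFData2) ∧
        LeafH3sup 4 F.L (ne3NperOfRecord₁₁ F 0 0) (ℓ₃ F).ε (b' F) (c' F) (ne3DomOfRecord₁₁ F N 0 0)) :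
    ∀ (F : T4Family) (θ : Stage13Params F N) (hP : θ.Provisos₁₃Sep F N), Rg F θ → θ.Admissible F N → ∀ (g₀ : ℕ → ℝ) (os : List (ULoop F)),
      N16At (rateCarriersOfRecord₁₃Sep (readingOfRecord₁₃Sep w1 ℓ₃ ne2 ne1) F θ hP g₀ os (ksel F θ g₀ os)).ne3 :=
  n16_tupleReadingOn_ofRecord_of_window_linear (fun F θ hP g₀ os => rateCarriersOfRecord₁₃Sep (readingOfRecord₁₃Sep w1 ℓ₃ ne2 ne1) F θ hP g₀ os (ksel F θ g₀ os)) Rg ℓ₃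
    (fun _ _ _ _ _ => rfl) hlen hlen1 hB₁' hBB hc₁' hwin hα hα1 hα2 hα3 hα4 hα5 hg hε0 hε hb hΛ₂' hb' hc' hΛ₁r hC hcontent

/-- **THE N16 LINE IN THE K3‴ SKELETON's CURRENCY AT THE LEVEL-SELECTED TUPLE READING OF RECORD, UNGUARDED** (plan g66's `KeyedRates rr` binder as registered). [folklore] -/
theorem n16_tupleReadingOfRecordSep_of_window_linear
    (hcontent : ∀ (F : T4Family), (∃ θ : Stage13Params F N, θ.Provisos₁₃Sep F N ∧ θ.Admissible F N) →
      letI : CStarAlgebra (Matrix (Fin N) (Fin N) ℂ) := {}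
      B8.Thm4Body (c₁ F) (B₁' F) (fun i : {i : ZdIdx 4 F.L // i.Ω 0 = Set.univ} => (zdGF3 (Matrix (Fin N) (Fin N) ℂ) F.L 1 (len F) i.1).toGFData) ∧
        B8.Prop3Body (cP F) 4 (F.L : ℝ) (C₂ F) (inp F) (B₀β F)
          (fun i : {i : ZdIdx 4 F.L // i.Ω 0 = Set.univ} => (zdGF3 (Matrix (Fin N) (Fin N) ℂ) F.L 1 (len F) i.1).toGFData2) ∧
        LeafH3sup 4 F.L (ne3NperOfRecord₁₁ F 0 0) (ℓ₃ F).ε (b' F) (c' F) (ne3DomOfRecord₁₁ F N 0 0)) :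
    ∀ (F : T4Family) (θ : Stage13Params F N) (hP : θ.Provisos₁₃Sep F N), θ.Admissible F N → ∀ (g₀ : ℕ → ℝ) (os : List (ULoop F)),
      N16At (rateCarriersOfRecord₁₃Sep (readingOfRecord₁₃Sep w1 ℓ₃ ne2 ne1) F θ hP g₀ os (ksel F θ g₀ os)).ne3 :=
  n16_tupleReading_ofRecord_of_window_linear (fun F θ hP g₀ os => rateCarriersOfRecord₁₃Sep (readingOfRecord₁₃Sep w1 ℓ₃ ne2 ne1) F θ hP g₀ os (ksel F θ g₀ os)) ℓ₃
    (fun _ _ _ _ _ => rfl) hlen hlen1 hB₁' hBB hc₁' hwin hα hα1 hα2 hα3 hα4 hα5 hg hε0 hε hb hΛ₂' hb' hc' hΛ₁r hC hcontent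

end LineOfRecord

/-! ## §3 ★ THE N16 LINE AT THE NAMED READING OF RECORD AT A PRINTED HÖLDER EXPONENT `β ∈ [0, 1]` (`S_N16Holder β`, dag-n16-c's β-kit) -/

section HolderLineOfRecord

variable (hβ0 : 0 ≤ β) (hβ1 : β ≤ 1)
  {len : T4Family → Site 4 → ℝ} {c₁ c₁' B₁' cP C₂ B₀β : T4Family → ℝ} {inp : T4Family → B8.B9Inputs} {α b' c' : T4Family → ℝ}
  (hlen : ∀ (F : T4Family) (v : Site 4), 0 < len F v → 1 ≤ len F v) (hlen1 : ∀ (F : T4Family) (μ : Fin 4), len F (e μ) = 1)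
  (hB₁' : ∀ F, 0 < B₁' F) (hBB : ∀ F : T4Family, 5 * ((4 : ℕ) : ℝ) * F.L * (inp F).B₀ ≤ B₁' F) (hc₁' : ∀ F, 0 < c₁' F)
  (hwin : ∀ (F : T4Family) (α₀ α₁ : ℝ), 0 < α₀ → 0 < α₁ → α₀ + α₁ ≤ c₁' F →
    α₀ + α₁ ≤ c₁ F ∧ C0 4 * (2 * α₀) ≤ 1 / 3 ∧ 4 * α₀ ≤ c2' 4 F.L ∧ 16 * (B₁' F * (α₀ + α₁)) ≤ 1 ∧
    Real.exp (4 * (800 * (((4 : ℕ) : ℝ) + 1) ^ 2 * (((4 : ℕ) : ℝ) + 4)) * α₀) * (1 + 8 * (131072 * (((4 : ℕ) : ℝ) + 1) ^ 2) * (B₁' F * (α₀ + α₁))) ≤ 2 ∧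
    2 * (B₁' F * (α₀ + α₁)) ≤ c3 4 F.L ∧ ((4 : ℕ) : ℝ) * F.L * α₁ ≤ 1 / 8 ∧ α₀ ≤ cP F ∧ α₁ ≤ cP F ∧ B₁' F * (α₀ + α₁) ≤ cP F ∧
    2 * (B₁' F * (α₀ + α₁)) ^ 2 + 20 * ((4 : ℕ) : ℝ) * α₀ * (B₁' F * (α₀ + α₁)) + 2 * C₂ F * (B₁' F * (α₀ + α₁)) ^ 2 ≤ α₀ + α₁)
  (hα : ∀ F, 0 < α F) (hα1 : ∀ F, α F ≤ c₁' F / 177)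
  (hα2 : ∀ F : T4Family, α F ≤ (ℓ₃ F).Λ₁ / (1770 * (5 * ((4 : ℕ) : ℝ) * F.L * (inp F).B₀) + 1))
  (hα3 : ∀ F : T4Family, α F ≤ c2' 4 F.L / 2)
  (hα4 : ∀ F : T4Family, α F ≤ 1 / ((23040 * (4 : ℝ) ^ 4 * (frameC 4 F.L + 4) ^ 3 + 12) * (1 + curConst 4 F.L) + 1))
  (hα5 : ∀ F, α F ≤ 1 / 10 ^ 9)
  (hg : ∀ F, 0 < (ℓ₃ F).g) (hε0 : ∀ F, 0 < (ℓ₃ F).ε) (hε : ∀ F, (ℓ₃ F).ε < α F)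
  (hΛ₁r : ∀ F : T4Family, (ℓ₃ F).Λ₁ ≤ radiusOfRecordH N F.L (ne3NperOfRecord₁₁ F 0 0))
  (hb : ∀ F, 0 ≤ (ℓ₃ F).b ∧ (ℓ₃ F).b ≤ (ℓ₃ F).ε / 2) (hC : ∀ F : T4Family, constOfRecordH N F.L (ne3NperOfRecord₁₁ F 0 0) (ℓ₃ F).g ≤ (ℓ₃ F).C)
  (hΛ₂' : ∀ F : T4Family, 177 * α F * (5 * ((4 : ℕ) : ℝ) * F.L * B₀β F + 5 * ((4 : ℕ) : ℝ) * F.L * (inp F).B₀) ≤ (ℓ₃ F).Λ₂')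
  (hb' : ∀ F, 0 ≤ b' F ∧ b' F ≤ α F / 2048) (hc' : ∀ F, 0 ≤ c' F ∧ c' F ≤ α F / 24)
include hβ0 hβ1 hlen hlen1 hB₁' hBB hc₁' hwin hα hα1 hα2 hα3 hα4 hα5 hg hε0 hε hΛ₁r hb hC hΛ₂' hb' hc'

/-- ★ **THE N16 LINE AT EXPONENT `β ∈ [0, 1]` AT THE REGIME-RESTRICTED READING OF RECORD, LINEAR CURRENCY** — N05's family at `zdGF3 (M_N ℂ) F.L β (len F)`, dag-n16-c's β-uniform
thresholds `radiusOfRecordH` ∕ `constOfRecordH`, N07's leaf letters linear; the three content clauses once per guarded family give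
`S_N16Holder β (RRec₁₃SepOn (readingOfRecord₁₃Sep w1 ℓ₃ ne2 ne1) Rg)` (module 20 §5 at `rfl`). [folklore] -/
theorem s_N16Holder_readingOfRecord₁₃SepOn_of_window_linear
    (hcontent : ∀ (F : T4Family), (∃ θ : Stage13Params F N, θ.Provisos₁₃Sep F N ∧ Rg F θ ∧ θ.Admissible F N) →
      letI : CStarAlgebra (Matrix (Fin N) (Fin N) ℂ) := {}
      B8.Thm4Body (c₁ F) (B₁' F) (fun i : {i : ZdIdx 4 F.L // i.Ω 0 = Set.univ} => (zdGF3 (Matrix (Fin N) (Fin N) ℂ) F.L β (len F) i.1).toGFData) ∧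
        B8.Prop3Body (cP F) 4 (F.L : ℝ) (C₂ F) (inp F) (B₀β F)
          (fun i : {i : ZdIdx 4 F.L // i.Ω 0 = Set.univ} => (zdGF3 (Matrix (Fin N) (Fin N) ℂ) F.L β (len F) i.1).toGFData2) ∧
        LeafH3sup 4 F.L (ne3NperOfRecord₁₁ F 0 0) (ℓ₃ F).ε (b' F) (c' F) (ne3DomOfRecord₁₁ F N 0 0)) :
    S_N16Holder β (RRec₁₃SepOn (readingOfRecord₁₃Sep w1 ℓ₃ ne2 ne1) Rg) :=
  s_N16Holder_rRec₁₃SepOn_ofRecord_of_window_linear β _ Rg hβ0 hβ1 ℓ₃ (readingOfRecord₁₃Sep_ne3 w1 ℓ₃ ne2 ne1) hlen hlen1 hB₁' hBB hc₁' hwin hα hα1 hα2 hα3 hα4 hα5 hg hε0 hε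
    hΛ₁r hb hC hΛ₂' hb' hc' hcontent

/-- **THE N16 LINE AT EXPONENT `β ∈ [0, 1]` AT THE CANONICAL READING OF RECORD, LINEAR CURRENCY** (content once per family carrying a Stage-13 datum of record). [folklore] -/
theorem s_N16Holder_readingOfRecord₁₃Sep_of_window_linear
    (hcontent : ∀ (F : T4Family), (∃ D : Datum F N, IsDatumOfRecord₁₃CSep F N D) →
      letI : CStarAlgebra (Matrix (Fin N) (Fin N) ℂ) := {}
      B8.Thm4Body (c₁ F) (B₁' F) (fun i : {i : ZdIdx 4 F.L // i.Ω 0 = Set.univ} => (zdGF3 (Matrix (Fin N) (Fin N) ℂ) F.L β (len F) i.1).toGFData) ∧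
        B8.Prop3Body (cP F) 4 (F.L : ℝ) (C₂ F) (inp F) (B₀β F)
          (fun i : {i : ZdIdx 4 F.L // i.Ω 0 = Set.univ} => (zdGF3 (Matrix (Fin N) (Fin N) ℂ) F.L β (len F) i.1).toGFData2) ∧
        LeafH3sup 4 F.L (ne3NperOfRecord₁₁ F 0 0) (ℓ₃ F).ε (b' F) (c' F) (ne3DomOfRecord₁₁ F N 0 0)) :
    S_N16Holder β (RRec₁₃Sep (readingOfRecord₁₃Sep w1 ℓ₃ ne2 ne1)) :=
  s_N16Holder_rRec₁₃Sep_ofRecord_of_window_linear β _ hβ0 hβ1 ℓ₃ (readingOfRecord₁₃Sep_ne3 w1 ℓ₃ ne2 ne1) hlen hlen1 hB₁' hBB hc₁' hwin hα hα1 hα2 hα3 hα4 hα5 hg hε0 hε hΛ₁r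
    hb hC hΛ₂' hb' hc' hcontent

end HolderLineOfRecord

end

end Summit.QuantumFields.YangMills.BalabanUVNodes.N16AtReadingOfRecord13Sep
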